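import Summits.BirchSwinnertonDyer.BirchSwinnertonDyer.Theses.UniversalToricDescent
import Summits.BirchSwinnertonDyer.BirchSwinnertonDyer.Theorems.UniversalToricDescentToricTransportModThreeStubRatSqueeze
import Summits.BirchSwinnertonDyer.BirchSwinnertonDyer.Theorems.UniversalToricDescentAcDualMuZeroCriterion
import Literature.NumberTheory.IwasawaTheory.ClassicalMuInvariant
import Literature.NumberTheory.EllipticCurves.ZpExtensionRestrict
import Literature.NumberTheory.EllipticCurves.DivisionField
import HarnessLib

/-!
# NODE `division_tower_mu_floor` — crux `AdditiveSplitIMCInclusionAtThree` (stmt-BirchSwinnertonDyer-20395, THE WALL, UTD)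
# crux-ideate STANDING COVER gen 8 (unit cruxidea-stmt-BirchSwinnertonDyer-20395-1-g8), 2026-08-30

D-0171 NODE for the crux idea `division-tower-mu-floor` (card `Ideas/division-tower-mu-floor.md`, line card
`Lines/division_tower_mu_floor.md`). KERNEL ROAD of record is unchanged (WALL ⟸ RATWALL 24207 ∧ the curve's own
`μ = 0`); what this node adds is a NUMBER-FIELD-SIDE reading of the `μ`-clause that uses NO `p`-adic `L`-function,
NO Euler/Kolyvagin system and NO twin: by Hochschild–Serre (`|GL₂(𝔽₃)| = 48`, bounded `H^i` errors) and the
prime-to-`3` isotypic projection INSIDE THE SYLOW-2 SUBGROUP `SD₁₆ ⊇ Q₈` (`3 ∤ 16`, so `𝔽₃[SD₁₆]` is semisimple; the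
central `-1` acts by `-1` on `E[3]`), the `μ`-rank of the residual Selmer group `Sel_(∅ at 𝔭′, 0 at 𝔭)(K_∞, E[3])` is
BOUNDED ABOVE, with bounded error, by the multiplicity of `E[3]|_{SD₁₆}` in the classical (`𝔭′`-ramified, `𝔭`-split)
Iwasawa module mod `3` of the ONE `ℤ₃`-extension `M_∞ = M·K_∞` of the `3`-division field `M = K(E[3])` — the
sufficient direction the wall needs. Its class-group half is the TYPED leaf `DivisionFieldClassicalMuVanishesAtThree`
below (Iwasawa's classical `μ = 0`, growth form, for the restricted tower `κ|_M` — tree objects `ZpExtension.restrict`,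
`ClassicalMuVanishes`, `WeierstrassCurve.divisionField`); Iwasawa's cubic Galois ascent (`M/K(T,μ₃)` cyclic of degree
`3`, ramification over `3N` finitely decomposed by Heegner) reduces it to the field `K(T, μ₃)`, and Iwasawa's descent
makes the octic `K(T)` of ONE `3`-torsion point (typed floor `TorsionPointFieldClassicalMuVanishesAtThree`) necessary;
the floor where every known closer stops is the quadratic step `K(T) ⊂ K(T,μ₃)` over the `ψ₃`-quartic `K(x(T))` (Galois
closure `S₄`, no CM subfield through which `E[3]` becomes reducible — barrier note B-g8-1). The unit half (`𝔭′`-adic signature of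
the `𝔭`-units of `M_n` modulo cubes, `E[3]`-part) is the number-field image of the REGULATOR half of
`X_(∅,0)` (relative_teeth RT2/RT3) and is left informal (definition request D1 on the card).

* TOP (`AdditiveSplitIMCInclusionAtThree_of`, kernel-checked): WALL ⟸ `stub_ratwall` (= route item 24207, WEAKER)
  ∧ `stub_residualFinite` (= the existing display `ResidualSelmerFiniteAtThreeSurj` of `Lines/fern_closure_doors`,
  `Lines/layer_fitting_doors`: `Sel_{𝔭′}(K_∞, E[3^∞])[3]` finite; UNDECIDED) — via the LANDED criterion
  `UniversalToricDescentAcDualMuZero.isTorsion_and_exists_generator_of_finite_pTorsion` (GV 2.8 shape) and the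
  `3`-saturation algebra of `Lines/toothwise_kolyvagin_mu` (`3` prime in `R₀⟦T⟧`).
* TYPED LEAF `DivisionFieldClassicalMuVanishesAtThree` (IDEA-NEEDED/BARRIER; no stub consumes it in Lean because its
  consumer — the capture lemma — needs residual Selmer groups over the layers of `κ|_M`, definition request D1).

Convention reminders: `(L) ⊆ Ch` is `Ch ∣ L`; `XAc.charIdeal = ⊤` off the torsion locus. `sorry` occurs ONLY inside
`stub_*`. Nothing here is a theorem about elliptic curves beyond the composition; BSD is not advanced by this file.
References: [Iwasawa1973MuInvariants] Thm. 2, §3; [CoatesSujatha2005] §3 (Thm. 3.4 and its proof); [GreenbergVatsal2000]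
§2 Prop. 2.8; [Washington1997] §13.2–13.3; [PerrinRiou1987] Ch. IV (anticyclotomic descent at finite level);
Greenberg, *Iwasawa theory, projective modules, and modular representations* (2011) §3 (isotypic Selmer bookkeeping).
-/

set_option linter.dupNamespace false
set_option autoImplicit false

noncomputable section

open Literature.NumberTheory.EllipticCurves
open Literature.NumberTheory.GaloisRepresentations (absGaloisRestrict)
open Literature.NumberTheory.IwasawaTheory (ClassicalMuVanishes)
open Summit.BirchSwinnertonDyer.BirchSwinnertonDyer.Theses.UniversalToricDescent
  (RationalSplitIMCInclusionAtThree AdditiveSplitIMCInclusionAtThree)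
open Summit.BirchSwinnertonDyer.BirchSwinnertonDyer.Cruxes.ToricTransportModThree.RatwallThinComb
  (dvd_of_dvd_prime_pow_mul prime_C_three not_C_three_dvd_of_norm_coeff_eq_one)
open Summit.BirchSwinnertonDyer.Rank1Residual.X11b

namespace Summit.BirchSwinnertonDyer.BirchSwinnertonDyer.Cruxes.AdditiveSplitIMCInclusionAtThree.DivisionTowerMuFloor

/-! ## §1 The pieces -/

/-- PIECE F (UNDECIDED; the `μ = 0 ∧ torsion` form of the wall's `μ`-clause — STRONGER than what the kernel road
strictly needs (`μ(X) ≤ μ(L)`, relative_teeth), equal to it whenever `μ(L_𝔭^{BDP}) = 0`). **Residual Selmer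
finiteness at `E`** on the UTD frame: `Sel_{𝔭′}(K_∞, E[3^∞])[3]` finite. Displayed verbatim from
`Lines/fern_closure_doors.lean` / `Lines/layer_fitting_doors.lean` (same normalised signature). Its NEW child is the
division-tower capture of the line card: `F ⟸ N1 ∧ (unit-signature half)`.
[cite: GreenbergVatsal2000, §2 Prop. (2.8)] [cite: Washington1997, §13.2] -/
def ResidualSelmerFiniteAtThreeSurj : Prop :=
  ∀ (W : WeierstrassCurve ℚ) [W.IsElliptic] [W.IsGloballyMinimal] (N : ℕ) [NeZero N] (K : Type) [Field K] [NumberField K], Summit.BirchSwinnertonDyer.Rank1Residual.Additive.ClassO6 W 3 → W.HasSurjectiveModNGaloisRep 3 → W.analyticRank = 1 → W.conductorNorm ℤ = N → Literature.NumberTheory.EllipticCurves.IsImaginaryQuadratic K → Literature.NumberTheory.EllipticCurves.SatisfiesHeegnerHypothesis N K → ∀ (κ : Literature.NumberTheory.EllipticCurves.ZpExtension K 3), κ.IsAnticyclotomic → ∀ (𝔭' : IsDedekindDomain.HeightOneSpectrum (NumberField.RingOfIntegers K)), ((3 : ℕ) : NumberField.RingOfIntegers K) ∈ 𝔭'.asIdeal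 → Set.Finite {s : Summit.BirchSwinnertonDyer.Rank1Residual.X11b.AcSelmer.selmerAc (W.baseChange K) 3 κ 𝔭' ∅ | (3 : ℕ) • s = 0}

/-- PIECE N1 (IDEA-NEEDED / BARRIER B-g8-1; the TYPED number-field leaf, class-group half of the capture).
**Iwasawa's classical `μ = 0` for the `3`-division tower.** For `E/ℚ` of class O6 at `3` with surjective `ρ̄_{E,3}`,
`K` imaginary quadratic, `κ` the anticyclotomic `ℤ₃`-extension of `K` and `M ≅ K(E[3])` (an abstract number field
`M` with a `K`-isomorphism onto the division field — no instance is declared), linearly disjoint from `K_∞`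
(automatic: `GL₂(𝔽₃)^{ab} ≅ ℤ/2`; kept as the binder `h`): the `3`-parts of the class numbers of the layers
`M·K_n` grow like `l·n + ν` (growth form of `μ(X_nr(M·K_∞/M)) = 0`, tree `ClassicalMuVanishes` of the restricted tower
`κ|_M`). NOT a consequence of Ferrero–Washington (base non-abelian), of Iwasawa 1973 (the steps `K ⊂ K(x(P)) ⊂ K(P)`
are prime to `3`), nor of Hida's anticyclotomic `μ = 0` (no CM field through which `E[3]` becomes reducible, B-g8-1);
the known reductions: UP from `K(T,μ₃)` by Iwasawa's cubic Galois ascent, DOWN to `K(T)` by Iwasawa's descent (line card §2).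
[cite: Iwasawa1973MuInvariants, Thm. 2 and §3] [cite: CoatesSujatha2005, §3 Thm. 3.4] [cite: Washington1997, §13.3] -/
def DivisionFieldClassicalMuVanishesAtThree : Prop :=
  ∀ (W : WeierstrassCurve ℚ) [W.IsElliptic] (K : Type) [Field K] [NumberField K],
    Summit.BirchSwinnertonDyer.Rank1Residual.Additive.ClassO6 W 3 → W.HasSurjectiveModNGaloisRep 3 →
    Literature.NumberTheory.EllipticCurves.IsImaginaryQuadratic K →
    ∀ (κ : Literature.NumberTheory.EllipticCurves.ZpExtension K 3), κ.IsAnticyclotomic →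
    ∀ (M : Type) [Field M] [NumberField M] [Algebra K M],
      Nonempty (M ≃ₐ[K] ↥((W.baseChange K).divisionField 3)) →
    ∀ (h : Function.Surjective (κ.toContinuousMonoidHom.comp (absGaloisRestrict K M))),
      ClassicalMuVanishes (κ.restrict M h)

/-- PIECE N0 (IDEA-NEEDED / BARRIER B-g8-1; the TYPED FLOOR, necessary for N1 by Iwasawa's descent
`μ(K/k) ≤ μ(K′/k′)`, tree `ClassicalMuVanishesFiniteDescent`). **Classical `μ = 0` over the field of ONE
`3`-torsion point.** Same frame as N1, with `M` replaced by an abstract number field `F ≅ K(T)`, the fixed field of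
the stabiliser of a non-zero `T ∈ E[3](K̄)` (`[K(T) : K] = 8`, the orbit of `T` under `GL₂(𝔽₃)`; `K(T) ⊃ K(x(T))`, the
`ψ₃`-quartic with Galois closure `S₄`). Over `K(T)` the curve acquires a rational `3`-torsion point, `E[3]` becomes
reducible (`0 → 𝔽₃ → E[3] → μ₃ → 0`), and `μ = 0` for `K(T)·K_∞/K(T)` is a statement about ONE explicit degree-16
number field with no CM and no abelian structure over `ℚ` or `K` — the floor at which Ferrero–Washington, Iwasawa 1973
and Hida 2010 all stop (line card §2; what climbs back from `K(T, μ₃)` to `M` is Iwasawa's cubic Galois ascent).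
[cite: Iwasawa1973MuInvariants, §3] [cite: Washington1997, §13.3 Prop. 13.22–13.23] [cite: SilvermanAEC2009, VIII.§1] -/
def TorsionPointFieldClassicalMuVanishesAtThree : Prop :=
  ∀ (W : WeierstrassCurve ℚ) [W.IsElliptic] (K : Type) [Field K] [NumberField K],
    Summit.BirchSwinnertonDyer.Rank1Residual.Additive.ClassO6 W 3 → W.HasSurjectiveModNGaloisRep 3 →
    Literature.NumberTheory.EllipticCurves.IsImaginaryQuadratic K →
    ∀ (κ : Literature.NumberTheory.EllipticCurves.ZpExtension K 3), κ.IsAnticyclotomic →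
    ∀ (T : ↥((W.baseChange K).geomTorsion 3)), T ≠ 0 →
    ∀ (F : Type) [Field F] [NumberField F] [Algebra K F],
      Nonempty (F ≃ₐ[K] ↥(IntermediateField.fixedField
        (MulAction.stabilizer (Field.absoluteGaloisGroup K) T))) →
    ∀ (h : Function.Surjective (κ.toContinuousMonoidHom.comp (absGaloisRestrict K F))),
      ClassicalMuVanishes (κ.restrict F h)

/-! ## §2 Registered stubs (`sorry` only here) -/

/-- STUB R (WEAKER than the wall; = route item 24207 `RationalSplitIMCInclusionAtThree` BY NAME, staffed there):
`∃ k, 3^k·L ∈ Ch·R₀⟦T⟧`. -/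
theorem stub_ratwall : RationalSplitIMCInclusionAtThree := by
  sorry

/-- STUB F (UNDECIDED): residual Selmer finiteness at `E`, `Sel_{𝔭′}(K_∞, E[3^∞])[3]` finite — the piece whose new
child (division-tower capture ⟸ N1 ∧ unit-signature half) is the content of the line card. -/
theorem stub_residualFinite : ResidualSelmerFiniteAtThreeSurj := by
  sorry

/-! ## §3 TOP composition: RATWALL + residual finiteness ⟹ THE WALL -/

/-- **The wall from the rational wall and residual Selmer finiteness.** `Sel_{𝔭′}(K_∞,E[3^∞])[3]` finite makes
`X = X_(∅,0)` `Λ`-torsion with `Ch·R₀⟦T⟧ = (g)`, `g` having a unit coefficient (LANDED criterion, GV 2.8 shape);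
then `3 ∤ g` in the domain `R₀⟦T⟧` where `3` is prime, so `g ∣ 3^k·L` (RATWALL) forces `g ∣ L`, i.e. `(L) ⊆ (g)`.
Concludes the crux `AdditiveSplitIMCInclusionAtThree` BY NAME.
[cite: GreenbergVatsal2000, §2 Prop. (2.8)] [cite: Washington1997, §7.1, §13.2] -/
theorem AdditiveSplitIMCInclusionAtThree_of :
    RationalSplitIMCInclusionAtThree → ResidualSelmerFiniteAtThreeSurj → AdditiveSplitIMCInclusionAtThree := by
  intro hR hF W _ _ N _ K _ _ Dt hO6 hsurj hr1 hN hK hH κ hκ γ _ 𝔭 h3 he hf 𝔭' h3' hne ι' hι ΩK Ωp L hΩK hΩp hL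
  obtain ⟨k, hk⟩ := hR W N K Dt hO6 hsurj hr1 hN hK hH κ hκ γ 𝔭 h3 he hf 𝔭' h3' hne ι' hι ΩK Ωp L hΩK hΩp hL
  have hfin := hF W N K hO6 hsurj hr1 hN hK hH κ hκ 𝔭' h3'
  obtain ⟨-, g, hg, i, hi⟩ :=
    Summit.BirchSwinnertonDyer.BirchSwinnertonDyer.Theorems.UniversalToricDescentAcDualMuZero.isTorsion_and_exists_generator_of_finite_pTorsion
      (W.baseChange K) 3 κ 𝔭' ∅ γ Set.finite_empty hfin
  rw [hg] at hk ⊢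
  have hdvd : g ∣ ((3 : ℕ) : UnrSeries 3) ^ k * L := Ideal.mem_span_singleton.mp hk
  rw [← map_natCast (PowerSeries.C (R := unrIntegers 3))] at hdvd
  exact Ideal.span_singleton_le_span_singleton.mpr
    (dvd_of_dvd_prime_pow_mul prime_C_three (not_C_three_dvd_of_norm_coeff_eq_one hi) k hdvd)

/-- The top composition run on the registered stubs: the crux BY NAME (sorries only through `stub_*`). -/
theorem AdditiveSplitIMCInclusionAtThree_holds_of_stubs : AdditiveSplitIMCInclusionAtThree :=
  AdditiveSplitIMCInclusionAtThree_of stub_ratwall stub_residualFinite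

end Summit.BirchSwinnertonDyer.BirchSwinnertonDyer.Cruxes.AdditiveSplitIMCInclusionAtThree.DivisionTowerMuFloor

end
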